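import Summits.BirchSwinnertonDyer.BirchSwinnertonDyer.Theorems.ManinLocalTwoThreePinningKernelStaged
import Summits.BirchSwinnertonDyer.BirchSwinnertonDyer.Theorems.ManinLocalTwoThreePinningFourHundredTablesF
import HarnessLib

/-!
# Level 400 by the PINNING KERNEL IN `S₂` — staged sieve certificates (part 7 of 11)

Cell `bsd-f2-manin`, route `ManinLocalTwoThree`, crux C2 `ManinOddAtFour` (stmt-BirchSwinnertonDyer-22967), an g57 (pipeline of an g56);
`--supports stmt-BirchSwinnertonDyer-22967` (helper).  The kernel certificates `hst0` … `hst4` (stages 0–4) of the staged box sieve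
of level 400 (stage `k` maps the live list `L_k` of `…PinningFourHundredTables` into `L_{k+1}`; large stages in chunks of at most `EXTCAP = 160` extensions (`3·EXTCAP/(4·r)` at a stage with `r ≥ 2` relations),
glued by part D's `sieveStep_subset_of_chunks`), split off the main file so that every file stays inside the farm's per-file
budget (depth `K = 192`: at `2⁴·5² ∣ N` every column divisible by `2` or `5` is dead; the certified column relations start at `p = 7` (columns `147 = 3·7²`, `189 = 3³·7`), so the sieve needs depth `192` and the `p = 17` stage still extends `36 × 17 = 612` assignments against two relations; the kernel keeps every intermediate of one `decide` alive, so each chunk is capped at ≈ 12 000 (extensions × relation length) (~2.6·10⁵ relation-term evaluations in all)).  Next = `…PinningFourHundredStagesB`; the last part `…PinningFourHundred` has the duals, the cover `hcover` (from `hst0 … hst6`), the Fricke sieve, `dim S₂` and the pinning theorems.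
HONEST FRAMING: kernel-checked evaluations of integer lists only; nothing here proves C2/C3, Manin's conjecture or BSD.
[cite: CremonaAlgorithms1997, §2.10] [cite: Koehler2011, §2.1]
-/


set_option autoImplicit false
-- lint-debt: the directory name repeats the summit name (sibling precedent `ManinLocalTwoThreePinningSixtyThree.lean`)
set_option linter.dupNamespace false

noncomputable section


open Complex
open UpperHalfPlane hiding I
open scoped MatrixGroups ModularForm
open ModularForm CongruenceSubgroup
open Literature.NumberTheory.ModularForms
open Literature.NumberTheory.EllipticCurves Literature.NumberTheory.EllipticCurves.ModularForms

namespace Summit.BirchSwinnertonDyer.BirchSwinnertonDyer.Theorems.ManinLocalTwoThree.PinningFourHundred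

open Summit.BirchSwinnertonDyer.BirchSwinnertonDyer.Theorems.ManinLocalTwoThree.BracketSturm
open Summit.BirchSwinnertonDyer.BirchSwinnertonDyer.Theorems.ManinLocalTwoThree.PinningKernel


set_option maxHeartbeats 4000000
set_option maxRecDepth 16384

/-! ## §2d-1 Sieve certificates `hst0` … `hst4` (stages 0–4) -/

/-- Sieve stage `0`: the live list `L_0` is mapped into `L_1` (kernel `decide`). [folklore] -/
theorem hst0 : ∀ σ ∈ sieveStep 400 192 ((([[]] : List (List (ℕ × ℤ))) :: lvs).getD 0 []) (stages.getD 0 (0, [])), σ ∈ lvs.getD 0 [] := by decide +kernel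
/-- Sieve stage `1`: the live list `L_1` is mapped into `L_2` (kernel `decide`). [folklore] -/
theorem hst1 : ∀ σ ∈ sieveStep 400 192 ((([[]] : List (List (ℕ × ℤ))) :: lvs).getD 1 []) (stages.getD 1 (0, [])), σ ∈ lvs.getD 1 [] := by decide +kernel
/-- Sieve stage `2`: the live list `L_2` is mapped into `L_3` (kernel `decide`). [folklore] -/
theorem hst2 : ∀ σ ∈ sieveStep 400 192 ((([[]] : List (List (ℕ × ℤ))) :: lvs).getD 2 []) (stages.getD 2 (0, [])), σ ∈ lvs.getD 2 [] := by decide +kernel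
/-- Stage 3 (`p = 7`, 7 live × box 11) is certified in 3 chunks. [folklore] -/
def chunks3 : List (List (List (ℕ × ℤ))) :=
  [[[(2, 0), (5, 0), (3, -3)], [(2, 0), (5, 0), (3, -2)], [(2, 0), (5, 0), (3, -1)]],
   [[(2, 0), (5, 0), (3, 0)], [(2, 0), (5, 0), (3, 1)], [(2, 0), (5, 0), (3, 2)]],
   [[(2, 0), (5, 0), (3, 3)]]]
/-- Sieve stage `3`, chunk `0` (kernel `decide`). [folklore] -/
theorem hst3c0 : ∀ σ ∈ sieveStep 400 192 (chunks3.getD 0 []) (stages.getD 3 (0, [])), σ ∈ lvs.getD 3 [] := by decide +kernel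
/-- Sieve stage `3`, chunk `1` (kernel `decide`). [folklore] -/
theorem hst3c1 : ∀ σ ∈ sieveStep 400 192 (chunks3.getD 1 []) (stages.getD 3 (0, [])), σ ∈ lvs.getD 3 [] := by decide +kernel
/-- Sieve stage `3`, chunk `2` (kernel `decide`). [folklore] -/
theorem hst3c2 : ∀ σ ∈ sieveStep 400 192 (chunks3.getD 2 []) (stages.getD 3 (0, [])), σ ∈ lvs.getD 3 [] := by decide +kernel
/-- Sieve stage `3`: the live list `L_3` is mapped into `L_4` (kernel `decide`). [folklore] -/
theorem hst3 : ∀ σ ∈ sieveStep 400 192 ((([[]] : List (List (ℕ × ℤ))) :: lvs).getD 3 []) (stages.getD 3 (0, [])), σ ∈ lvs.getD 3 [] :=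
  sieveStep_subset_of_chunks 400 192 chunks3 (by decide +kernel) fun j hj ↦ by
    have hj' : j < 3 := lt_of_lt_of_eq hj (by decide)
    interval_cases j
    exacts [hst3c0, hst3c1, hst3c2]
/-- Stage 4 (`p = 11`, 10 live × box 13) is certified in 2 chunks. [folklore] -/
def chunks4 : List (List (List (ℕ × ℤ))) :=
  [[[(2, 0), (5, 0), (3, -3), (7, 2)], [(2, 0), (5, 0), (3, -2), (7, -2)], [(2, 0), (5, 0), (3, -2), (7, 2)], [(2, 0), (5, 0), (3, -1), (7, -2)], [(2, 0), (5, 0), (3, 0), (7, -4)], [(2, 0), (5, 0), (3, 0), (7, 4)], [(2, 0), (5, 0), (3, 1), (7, 2)]],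
   [[(2, 0), (5, 0), (3, 2), (7, -2)], [(2, 0), (5, 0), (3, 2), (7, 2)], [(2, 0), (5, 0), (3, 3), (7, -2)]]]
/-- Sieve stage `4`, chunk `0` (kernel `decide`). [folklore] -/
theorem hst4c0 : ∀ σ ∈ sieveStep 400 192 (chunks4.getD 0 []) (stages.getD 4 (0, [])), σ ∈ lvs.getD 4 [] := by decide +kernel
/-- Sieve stage `4`, chunk `1` (kernel `decide`). [folklore] -/
theorem hst4c1 : ∀ σ ∈ sieveStep 400 192 (chunks4.getD 1 []) (stages.getD 4 (0, [])), σ ∈ lvs.getD 4 [] := by decide +kernel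
/-- Sieve stage `4`: the live list `L_4` is mapped into `L_5` (kernel `decide`). [folklore] -/
theorem hst4 : ∀ σ ∈ sieveStep 400 192 ((([[]] : List (List (ℕ × ℤ))) :: lvs).getD 4 []) (stages.getD 4 (0, [])), σ ∈ lvs.getD 4 [] :=
  sieveStep_subset_of_chunks 400 192 chunks4 (by decide +kernel) fun j hj ↦ by
    have hj' : j < 2 := lt_of_lt_of_eq hj (by decide)
    interval_cases j
    exacts [hst4c0, hst4c1]

end Summit.BirchSwinnertonDyer.BirchSwinnertonDyer.Theorems.ManinLocalTwoThree.PinningFourHundred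

end
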